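import Summits.BirchSwinnertonDyer.BirchSwinnertonDyer.Theorems.ByReductionTypeAtTwoMultTowerNS2TateUnit
import Summits.BirchSwinnertonDyer.BirchSwinnertonDyer.Theorems.ByReductionTypeAtTwoMultTowerNS2Dyadic
import Summits.BirchSwinnertonDyer.Rank1Residual.Additive.CyclotomicThreeMultiplicativeReduction
import Literature.NumberTheory.EllipticCurves.TateCurve.NumberField
import Literature.NumberTheory.EllipticCurves.LFunctionPrimeCoeff
import Literature.NumberTheory.GaloisRepresentations.PadicAlgebraOfLocalField
import Mathlib.NumberTheory.Padics.RingHoms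
import HarnessLib

/-!
# Route `ByReductionTypeAtTwo`, crux `MultUpperHalfAtTwo` (item stmt-BirchSwinnertonDyer-19922), TOWER road, the
# «ONE BIT AT A NON-SPLIT 2» rows: KERNEL BRICK 6 — the Tate unit of `E/ℚ` at `v ∋ 2` transported to `ℤ_[2]`:
# `padicEquiv q = 2^k · u'` with `u' ≡ (Δ_min/2^k)·c₄ (mod 8)`

HONEST FRAMING (cell `bsd-2adic`, run/shared/lean/pub/bsd-2adic/, seat `bsd-2adic-tower-1` GEN 8, HUMAN RULINGS
D-0036 / D-0054 / D-0074): TOOL theorems only (no definition, no named fact, no `sorry`); closes nothing by itself;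
nothing booked; BSD is not proved by any of this. This file FINISHES module M3 of the KERNELISATION of the displayed MEMO
binder `MultTowerNS2.localTowerKerTwoTorsion_le_two_nonsplitTwo_of_tateUnit` (scope HOME/tower/SCOPE-hNS2one-kernel-GEN8.md S7;
memo PROOF-NS2ONE §6): for `W/ℚ` globally minimal with multiplicative reduction at `2`, `Δ_min = 2^k u`, `c₄ = c`,
`u·c ≡ ±3 (mod 8)` (the binder's hypothesis, verbatim) and ANY `q ∈ ℚ_v` (`v ∋ 2`) with `0 < v(q) < 1` and
`tateJ q = j(W ⊗ ℚ_v)` — as delivered by `TateCurve.exists_twistedTateUniformisation_tateJ` — the image of `q` under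
Mathlib's `ℚ_v ≃ₐ[ℚ] ℚ_[p]` (`p = primesEquiv v`, `= 2`) is `2^k · u'` with `u' ∈ ℤ_[p]` and
`toZModPow 3 u' ∈ {3, 5}`: exactly the hypothesis of BRICK 2 (`MultTowerNS2.sq_sub_mul_sq_ne_two_of_tateUnit`, the dyadic
non-norm `x² − (2^k u') y² ≠ 2`). Ingredients: BRICK 5 `norm_tateUnit_sub_le` (any complete ultrametric field with
`|2| < 1`) at `K = ℚ_v`; `|2|_v < 1` (`LocalField.valuation_adicCompletion_natCast_lt_one`); `j = c₄³/Δ`,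
`Δ = Δ_min` (`cast_minimalDiscriminantInt`); `2 ∣ Δ_min` at a multiplicative `2`
(`Additive.dvd_and_not_dvd_c₄_of_hasMultiplicativeReductionAtPrime`), so `k ≥ 1`; integrality transport along
`padicEquiv` (`padicEquiv_mem_range_iff_ringOfIntegers`); `ker (toZModPow 3) = (p³) = (8)`.

* `exists_padicInt_tateUnit_of_tateJ_eq` — the statement above (`∃ u' : ℤ_[p], e q = 2^k u' ∧ toZModPow 3 u' ∈ {3,5}`);
* `sq_sub_mul_sq_ne_two_of_tateUnit'` — BRICK 2 at a prime index `p` provably equal to `2`.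

References: Silverman *ATAEC* V.3.1 (b), V.5.3 (a); cell memo PROOF-NS2ONE.md §6; scope memo SCOPE-hNS2one-kernel-GEN8.md S7/M3.
-/

set_option autoImplicit false
-- the Theorems namespace of this sub repeats the summit name by design (D-0017 nested layout: Summit.<S>.<Sub>)
set_option linter.dupNamespace false

noncomputable section

open scoped Classical

namespace Summit.BirchSwinnertonDyer.BirchSwinnertonDyer.Theorems.MultTowerNS2

open NumberField IsDedekindDomain WeierstrassCurve PadicInt Rat.HeightOneSpectrum
  Literature.NumberTheory.EllipticCurves Literature.NumberTheory.GaloisRepresentations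
  Summit.BirchSwinnertonDyer.Rank1Residual

/-- BRICK 2 (`sq_sub_mul_sq_ne_two_of_tateUnit`, stated over `ℚ_[2]`) at any prime index `p` provably equal to `2`
(for use at `p = primesEquiv v`). [folklore] -/
theorem sq_sub_mul_sq_ne_two_of_tateUnit' (p : ℕ) [Fact p.Prime] (hp : p = 2) {u : ℤ_[p]}
    (hu : toZModPow 3 u = 3 ∨ toZModPow 3 u = 5) (k : ℕ) (x y : ℚ_[p]) :
    x ^ 2 - ((2 : ℚ_[p]) ^ k * u) * y ^ 2 ≠ 2 := by
  subst hp
  exact sq_sub_mul_sq_ne_two_of_tateUnit hu k x y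

variable (W : WeierstrassCurve ℚ) [W.IsElliptic] [W.IsGloballyMinimal]

/-- **The Tate unit of `E/ℚ` at `v ∋ 2`, in `ℤ_[2]`.** Let `W/ℚ` be globally minimal with multiplicative reduction at
`2`, `Δ_min = 2^k u`, `c₄ = c` with `u·c ≡ 3` or `5 (mod 8)`, `v ∋ 2`, and `q ∈ ℚ_v` with `q ≠ 0`, `v(q) < 1` and
`tateJ q = j(W ⊗ ℚ_v)` (Silverman V.5.3 (a); the tree's `TateCurve.exists_twistedTateUniformisation_tateJ`). Then, along
Mathlib's `e = padicEquiv v : ℚ_v ≃ₐ[ℚ] ℚ_[p]` (`p = primesEquiv v = 2`), `e q = 2^k · u'` for a `2`-adic integer `u'`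
with `toZModPow 3 u' = 3` or `= 5` — i.e. the Tate unit is `≡ u·c (mod 8)` (BRICK 5 `norm_tateUnit_sub_le` at `K = ℚ_v`:
`|q/2^k − u c|_v ≤ |8|_v`, transported by the integrality-preserving `e`). [folklore] -/
theorem exists_padicInt_tateUnit_of_tateJ_eq (hmult : W.HasMultiplicativeReductionAtPrime 2) {k : ℕ} {u c : ℤ}
    (hΔ : W.minimalDiscriminantInt = 2 ^ k * u) (hc₄ : W.c₄ = (c : ℚ)) (huc : u * c % 8 = 3 ∨ u * c % 8 = 5)
    (v : HeightOneSpectrum (𝓞 ℚ)) (hpv : ((2 : ℕ) : 𝓞 ℚ) ∈ v.asIdeal) {q : v.adicCompletion ℚ} (hq0 : q ≠ 0)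
    (hqv : Valued.v q < 1) (hqj : tateJ q = (W.baseChange (v.adicCompletion ℚ)).j) :
    haveI := Fact.mk (primesEquiv v).2
    ∃ u' : ℤ_[(primesEquiv v : ℕ)],
      (adicCompletion.padicEquiv v).toAlgEquiv.toRingEquiv q = (2 : ℚ_[(primesEquiv v : ℕ)]) ^ k * (u' : ℚ_[_]) ∧
        (toZModPow 3 u' = 3 ∨ toZModPow 3 u' = 5) := by
  haveI := Fact.mk (primesEquiv v).2
  set e := (adicCompletion.padicEquiv v).toAlgEquiv.toRingEquiv with he
  have h2ne : (2 : (v.adicCompletion ℚ)) ≠ 0 := by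
    have h := (algebraMap ℚ (v.adicCompletion ℚ)).injective.ne (two_ne_zero (α := ℚ))
    simpa using h
  have h8ne : (8 : (v.adicCompletion ℚ)) ≠ 0 := by
    have h := (algebraMap ℚ (v.adicCompletion ℚ)).injective.ne (show (8 : ℚ) ≠ 0 by norm_num)
    simpa using h
  have hv : (primesEquiv v : ℕ) = 2 := primesEquiv_eq_of_natCast_mem v Nat.prime_two hpv
  -- parities
  have hodd : Odd (u * c) := by
    rw [Int.odd_iff]
    rcases huc with h | h <;> omega
  obtain ⟨hu, hc⟩ := Int.odd_mul.mp hodd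
  -- `k ≥ 1`: `2 ∣ Δ_min = 2^k u` with `u` odd
  have hk : 1 ≤ k := by
    obtain ⟨h2Δ, -⟩ := Additive.dvd_and_not_dvd_c₄_of_hasMultiplicativeReductionAtPrime W 2 hmult
    rw [hΔ] at h2Δ
    by_contra hk0
    have hk0' : k = 0 := by omega
    rw [hk0', pow_zero, one_mul] at h2Δ
    exact (Int.not_even_iff_odd.mpr hu) (even_iff_two_dvd.mpr (by exact_mod_cast h2Δ))
  -- `|2|_v < 1` and `|q|_v < 1`
  have h2 : ‖(2 : (v.adicCompletion ℚ))‖ < 1 := by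
    rw [Valued.toNormedField.norm_lt_one_iff]
    have h := LocalField.valuation_adicCompletion_natCast_lt_one v 2 hpv
    rw [← (ValuativeRel.valuation (v.adicCompletion ℚ)).vlt_one_iff, (Valued.v (R := (v.adicCompletion ℚ))).vlt_one_iff] at h
    exact_mod_cast h
  have hq1 : ‖q‖ < 1 := Valued.toNormedField.norm_lt_one_iff.mpr hqv
  -- `tateJ q = c³ / (2^k u)`
  have hj : tateJ q = (c : (v.adicCompletion ℚ)) ^ 3 / ((2 : (v.adicCompletion ℚ)) ^ k * (u : (v.adicCompletion ℚ))) := by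
    refine hqj.trans ((W.map_j _).trans ?_)
    rw [j, Units.val_inv_eq_inv_val, coe_Δ', ← cast_minimalDiscriminantInt W, hΔ, hc₄, map_mul, map_inv₀,
      map_pow, map_intCast, map_intCast]
    push_cast
    rw [inv_mul_eq_div]
  -- BRICK 5: `|q/2^k − u c| ≤ |2|³`
  have hw := norm_tateUnit_sub_le h2 hq0 hq1 hk hu hc hj
  -- the difference is `8 ×` a `v`-adic integer
  have h8n : ‖(8 : (v.adicCompletion ℚ))‖ = ‖(2 : (v.adicCompletion ℚ))‖ ^ 3 := by
    rw [show (8 : (v.adicCompletion ℚ)) = 2 ^ 3 by norm_num, norm_pow]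
  have h8pos : 0 < ‖(8 : (v.adicCompletion ℚ))‖ := norm_pos_iff.mpr h8ne
  set d : (v.adicCompletion ℚ) := (q / (2 : (v.adicCompletion ℚ)) ^ k - (u : (v.adicCompletion ℚ)) * (c : (v.adicCompletion ℚ))) / 8 with hd
  have hdn : ‖d‖ ≤ 1 := by
    rw [hd, norm_div, div_le_one h8pos, h8n]
    exact hw
  obtain ⟨r, hr⟩ := (TateCurve.norm_le_one_iff_mem_range_adicCompletionIntegers ℚ v d).mp hdn
  -- transport along `e`
  have hzr := (padicEquiv_mem_range_iff_ringOfIntegers v d).mpr ⟨r, hr⟩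
  obtain ⟨z, hz⟩ := hzr
  have hqd : q = (2 : (v.adicCompletion ℚ)) ^ k * (((u * c : ℤ) : (v.adicCompletion ℚ)) + 8 * d) := by
    have h2k : (2 : (v.adicCompletion ℚ)) ^ k ≠ 0 := pow_ne_zero _ h2ne
    rw [hd]; push_cast; field_simp; ring
  have he2 : e (2 : (v.adicCompletion ℚ)) = 2 := by rw [he, map_ofNat]
  have he8 : e (8 : (v.adicCompletion ℚ)) = 8 := by rw [he, map_ofNat]
  have heuc : e ((u * c : ℤ) : (v.adicCompletion ℚ)) = ((u * c : ℤ) : ℚ_[(primesEquiv v : ℕ)]) := by rw [he, map_intCast]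
  have hz' : (z : ℚ_[(primesEquiv v : ℕ)]) = e d := hz
  refine ⟨(u * c : ℤ) + ((8 : ℤ) : ℤ_[(primesEquiv v : ℕ)]) * z, ?_, ?_⟩
  · have h8c : ((8 : ℤ_[(primesEquiv v : ℕ)]) : ℚ_[(primesEquiv v : ℕ)]) = 8 := by norm_cast
    rw [hqd, map_mul, map_pow, he2, map_add, heuc, map_mul, he8, ← hz']
    push_cast
    rw [h8c]
  · -- `toZModPow 3 (u c + 8 z) = u c mod 8 ∈ {3, 5}`
    have hpz : ((primesEquiv v : ℕ) : ℤ) = 2 := by exact_mod_cast hv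
    have h8 : ((8 : ℤ) : ZMod ((primesEquiv v : ℕ) ^ 3)) = 0 := by
      rw [ZMod.intCast_zmod_eq_zero_iff_dvd]
      push_cast
      rw [hpz]; norm_num
    have hcast : (((u * c : ℤ)) : ZMod ((primesEquiv v : ℕ) ^ 3)) =
        (((u * c) % 8 : ℤ) : ZMod ((primesEquiv v : ℕ) ^ 3)) := by
      rw [← ZMod.intCast_mod (u * c) ((primesEquiv v : ℕ) ^ 3)]
      push_cast
      rw [hpz]; norm_num
    rw [map_add, map_mul, map_intCast, map_intCast, h8, zero_mul, add_zero, hcast]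
    rcases huc with h | h <;> rw [h]
    · left; norm_cast
    · right; norm_cast

end Summit.BirchSwinnertonDyer.BirchSwinnertonDyer.Theorems.MultTowerNS2

end
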